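import Literature.AnabelianGeometry.SemiGraphs.TemperedCurvePiTowerOfDeltaTower
import Literature.AnabelianGeometry.SemiGraphs.TemperedSpecialFibreTowerVertexAction
import HarnessLib

/-!
# [SemiAnbd] Ex. 3.10 — the BRIDGE: the André tower of `Π^temp_{X_K}` from the special-fibre tower
# of `Δ^temp_X` with characteristic André towers at the levels `π₁^temp(𝒢_i)`

Mochizuki, *Semi-graphs of anabelioids*, Publ. RIMS **42** (2006) [SemiAnbd], Example 3.10 pp. 43–45
("an exhaustive sequence of open characteristic … subgroups … `⊆ N_i ⊆ … ⊆ Δ` … semi-graphs of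
anabelioids `𝒢_i`, `𝒢^c_i` on which `Δ_i` acts faithfully … surjections of tempered groups
`Δ ↠ … ↠ Δ[i] := π₁^temp(𝒢_i) ⋊^out Δ_i ↠ … ↠ π₁^temp(𝒢)` … `Δ` is the inverse limit of the `Δ[i]`"),
§6 p. 69 (`1 → Δ^temp_X → Π^temp_{X_K} → G_K → 1`; Lem. 6.1 via [André] §4.5); S. Mochizuki,
*Inter-universal Teichmüller theory I*, proof of Prop. 2.4 (i) p. 50 (the action of `Π^tp_X` on the
special fibre of `X_J` through `Π^tp_X/J`). [cite: MochizukiSemiAnbd2006, Ex 3.10 pp.44-45]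

PROOF-ONLY file (abc-iut cell, prover abc-iut-w5-d240, row «Ex310-CURVE-BRIDGE» (L3-lead α106),
step S3; no definitions, no instances, no named facts).  The cell's discharges of the [SemiAnbd] §6
instance forms (F-1661/F-1693/F-1705–07) and of [EtTh] Lem. 2.17 (ii) (F-0606) consume the André
tower input `htower₀` for `Π^temp_{X_K}` BY NAME.  This file derives it from Example 3.10's
special-fibre tower over `Δ^temp_X` (`SpecialFibreTower`, seat abc-iut-w5-d122; levels `N_i`, charts
`π₁^temp(𝒢_i)`, admissible quotients `adm_i : N_i ↠ π₁^temp(𝒢_i)`), given exactly: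

* (P0) `hP0` — the admissible kernels are normal in `Π^temp_{X_K}` (field `admKer_normal_pi` of
  `SpecialFibreTower.PiData`, seat abc-iut-L3-t2; [IUTchI] p. 50: `X_{N_i} → X_K` is Galois);
* (h1) `hlim` — "`Δ` is the inverse limit of the `Δ[i]`" (p. 45 l. 10) read TOPOLOGICALLY: every
  neighbourhood of `1` in `Δ^temp_X` contains the `adm_i`-preimage of a neighbourhood of `1` of some
  `π₁^temp(𝒢_i)` (the structure `SpecialFibreTower` records only the set-theoretic `admKer_separating`);
* (B1′) `hch` — at every level, `π₁^temp(𝒢_i)` has a CHARACTERISTIC André tower: inside every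
  neighbourhood of `1` an open normal subgroup stable under every topological-group automorphism of
  `π₁^temp(𝒢_i)` whose quotient contains a free, finite-rank, non-abelian subgroup of finite index.
  For finite `𝔾_i` with a closed edge the André tower itself is the tree THEOREM
  `TemperedPiChart.tower_of_isClosedEdge` (p440108); that it can be taken characteristic — the kernels
  `Ker(π₁^temp(𝒢_L) → π₁(𝔾_L))` at characteristic levels `L` are generated topologically by compact
  subgroups (Bass–Serre) — is the MODEL-LEVEL residual recorded with this file (GAP-LEDGER), not an
  axiom about the curve.

Mechanism (`SpecialFibreTower.exists_openNormal_piNormal_of_charLevel`, generic over a normal subgroup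
`Δ` of a topological group `Π` carrying a special-fibre tower): for a characteristic open normal
`M_Q ⊴ π₁^temp(𝒢_i)`, the subgroup `M := adm_i⁻¹(M_Q) ≤ N_i ≤ Δ` is open in `Δ` and NORMAL IN `Π`,
because conjugation by `g ∈ Π` induces a topological-group automorphism `autOfConj g` of
`π₁^temp(𝒢_i)` through `adm_i` (seat abc-iut-L3-t2's `TemperedSpecialFibreTowerVertexAction.lean`,
from (P0) and `N_char`) which preserves `M_Q`; and `π₁^temp(𝒢_i)/M_Q ≅ N_i/(M ∩ N_i) ↪ Δ/M` has finite
index.  Then `TemperedCurve.tower_of_piNormal_deltaTower` (S1, `TemperedCurvePiTowerOfDeltaTower.lean`)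
extends to `Π^temp_{X_K}` by the open augmentation onto the compact `G_K`:

* `TemperedCurve.piNormal_deltaTower_of_specialFibreTower` — the `Π`-normal André tower of `Δ^temp_X`;
* `TemperedCurve.tower_of_specialFibreTower` (+ `'` under `d : X.GroupLevelData`, and the `Δ^temp_X`
  form) — **`htower₀` for `Π^temp_{X_K}` from (P0) + (h1) + (B1′)**.

Honest limits: (h1) and (B1′) are binders of the theorems, displayed in their statements; nothing of
the paper is asserted; nothing here bears on [IUTchIII] Cor. 3.12 or takes a side on any disputed claim.
-/

noncomputable section

namespace Literature.AnabelianGeometry.SemiGraphs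

open _root_.Topology
open scoped Pointwise
open Literature.GroupTheory.CombinatorialGroupTheory

universe u

/-! ### Generic core: a characteristic level of a chart gives a `Π`-normal open subgroup of `Δ` -/

namespace SpecialFibreTower

variable {Γ : Type u} [Group Γ] [TopologicalSpace Γ] [IsTopologicalGroup Γ] {Δ : Subgroup Γ}
  [hΔ : Δ.Normal] (T : SpecialFibreTower Δ)

/-- **A characteristic open normal subgroup of a level chart pulls back to a `Π`-normal open subgroup
of `Δ` with a quotient at least as large.**  Let `T` be a special-fibre tower over a normal subgroup
`Δ ⊴ Π` whose admissible kernels are normal in `Π` (P0), `i` a level, and `M_Q ⊴ π₁^temp(𝒢_i)` an open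
normal subgroup of the chart group stable under every topological-group automorphism.  Then
`M := adm_i⁻¹(M_Q) ≤ N_i`, viewed in `Δ`, is an open normal subgroup whose image in `Π` is NORMAL
(conjugation by `g ∈ Π` acts on `π₁^temp(𝒢_i)` through `autOfConj g`, [IUTchI] Prop. 2.4 (i) p. 50), and
every free, finite-rank, non-abelian finite-index subgroup of `π₁^temp(𝒢_i)/M_Q` gives one of `Δ/M`
(`π₁^temp(𝒢_i)/M_Q ≅ N_i/(M ∩ N_i) ↪ Δ/M` with finite index `≤ [Δ : N_i]`).
[cite: MochizukiSemiAnbd2006, Ex 3.10 pp.44-45] -/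
theorem exists_openNormal_piNormal_of_charLevel (hP0 : ∀ i, ((T.admKer i).map Δ.subtype).Normal)
    (i : ℕ) (MQ : OpenNormalSubgroup (T.chart i).G)
    (hchar : ∀ φ : (T.chart i).G ≃ₜ* (T.chart i).G,
      MQ.toSubgroup.map φ.toMulEquiv.toMonoidHom ≤ MQ.toSubgroup)
    (G : Subgroup ((T.chart i).G ⧸ MQ.toSubgroup)) (hG : IsFreeGroup G) [G.FiniteIndex]
    (hGfin : Finite (IsFreeGroup.Generators G)) (hab : ∃ a ∈ G, ∃ b ∈ G, a * b ≠ b * a) :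
    ∃ M : OpenNormalSubgroup Δ, (M.toSubgroup.map Δ.subtype).Normal ∧
      (∀ x : Δ, x ∈ M ↔ ∃ n : T.N i, T.adm i n ∈ MQ ∧ (n : Δ) = x) ∧
      ∃ (K : Subgroup (Δ ⧸ M.toSubgroup)) (_ : IsFreeGroup K), K.FiniteIndex ∧
        Finite (IsFreeGroup.Generators K) ∧ ∃ a ∈ K, ∃ b ∈ K, a * b ≠ b * a := by
  classical
  haveI : MQ.toSubgroup.Normal := MQ.isNormal'
  -- `M₀ := adm_i⁻¹(M_Q) ≤ N_i` and its image `L ≤ Δ`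
  let M₀ : Subgroup (T.N i) := MQ.toSubgroup.comap (T.adm i).toMonoidHom
  let L : Subgroup Δ := M₀.map (T.N i).subtype
  have hLmem : ∀ x : Δ, x ∈ L ↔ ∃ n : T.N i, T.adm i n ∈ MQ ∧ (n : Δ) = x := by
    intro x
    constructor
    · rintro ⟨n, hn, rfl⟩; exact ⟨n, hn, rfl⟩
    · rintro ⟨n, hn, rfl⟩; exact ⟨n, hn, rfl⟩
  -- `L` is open in `Δ` (`N_i` is open, `adm_i` continuous, `M_Q` open)
  have hLopen : IsOpen (L : Set Δ) := by
    have hset : (L : Set Δ) = Subtype.val '' ((T.adm i) ⁻¹' (MQ : Set (T.chart i).G)) := by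
      ext x
      simp only [SetLike.mem_coe, hLmem, Set.mem_image, Set.mem_preimage]
    rw [hset]
    exact (T.isOpen_N i).isOpenMap_subtype_val _
      (MQ.toOpenSubgroup.isOpen.preimage (T.adm i).continuous)
  -- `L` is stable under conjugation by every `g ∈ Π`: `adm (g n g⁻¹) = autOfConj g (adm n) ∈ M_Q`
  have hLconj : ∀ (g : Γ) (x : Δ), x ∈ L → conjDelta g x ∈ L := by
    intro g x hx
    obtain ⟨n, hn, rfl⟩ := (hLmem x).1 hx
    refine (hLmem _).2 ⟨T.conjN i g n, ?_, rfl⟩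
    have h1 : T.adm i (T.conjN i g n) = T.autOfConj hP0 i g (T.adm i n) :=
      (T.autOfConj_adm hP0 i g n).symm
    rw [h1]
    exact hchar (T.autOfConj hP0 i g) ⟨T.adm i n, hn, rfl⟩
  have hLnormal : L.Normal := ⟨fun x hx g => by
    have h := hLconj (g : Γ) x hx
    have heq : conjDelta (Δ := Δ) (g : Γ) x = g * x * g⁻¹ :=
      Subtype.ext (by simp only [coe_conjDelta, Subgroup.coe_mul, Subgroup.coe_inv])
    rw [heq] at h
    exact h⟩
  have hLpi : (L.map Δ.subtype).Normal := ⟨fun y hy g => by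
    obtain ⟨x, hx, rfl⟩ := hy
    exact ⟨conjDelta g x, hLconj g x hx, by simp only [Subgroup.coe_subtype, coe_conjDelta]⟩⟩
  let M : OpenNormalSubgroup Δ := { toSubgroup := L, isOpen' := hLopen, isNormal' := hLnormal }
  refine ⟨M, hLpi, hLmem, ?_⟩
  -- `σ : N_i ↠ π₁^temp(𝒢_i)/M_Q`, `ρ : N_i → Δ/M`, and the injection `θ : π₁^temp(𝒢_i)/M_Q ↪ Δ/M`
  haveI : M.toSubgroup.Normal := hLnormal
  let σ : T.N i →* (T.chart i).G ⧸ MQ.toSubgroup :=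
    (QuotientGroup.mk' MQ.toSubgroup).comp (T.adm i).toMonoidHom
  have hσ : Function.Surjective σ :=
    (QuotientGroup.mk'_surjective _).comp (T.adm_surjective i)
  have hσapply : ∀ n : T.N i, σ n = ((T.adm i n : (T.chart i).G) : (T.chart i).G ⧸ MQ.toSubgroup) :=
    fun _ => rfl
  let ρ : T.N i →* Δ ⧸ M.toSubgroup := (QuotientGroup.mk' M.toSubgroup).comp (T.N i).subtype
  have hρapply : ∀ n : T.N i, ρ n = ((n : Δ) : Δ ⧸ M.toSubgroup) := fun _ => rfl
  have hker : σ.ker ≤ ρ.ker := by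
    intro n hn
    rw [MonoidHom.mem_ker, hσapply] at hn
    rw [MonoidHom.mem_ker, hρapply]
    have hn' : T.adm i n ∈ MQ.toSubgroup := (QuotientGroup.eq_one_iff _).1 hn
    exact (QuotientGroup.eq_one_iff _).2 ((hLmem _).2 ⟨n, hn', rfl⟩)
  let θ : ((T.chart i).G ⧸ MQ.toSubgroup) →* Δ ⧸ M.toSubgroup := σ.liftOfSurjective hσ ⟨ρ, hker⟩
  have hθσ : ∀ n : T.N i, θ (σ n) = ((n : Δ) : Δ ⧸ M.toSubgroup) := fun n =>
    MonoidHom.liftOfRightInverse_comp_apply _ _ _ _ n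
  have hθinj : Function.Injective θ := by
    rw [injective_iff_map_eq_one]
    intro q hq
    obtain ⟨n, rfl⟩ := hσ q
    rw [hθσ] at hq
    have hn : (n : Δ) ∈ M.toSubgroup := (QuotientGroup.eq_one_iff _).1 hq
    obtain ⟨n', hn', hnn'⟩ := (hLmem _).1 hn
    have hn'n : n' = n := Subtype.ext hnn'
    subst hn'n
    rw [hσapply]
    exact (QuotientGroup.eq_one_iff _).2 hn'
  have hθrange : θ.range = (T.N i).map (QuotientGroup.mk' M.toSubgroup) := by
    ext q
    constructor
    · rintro ⟨r, rfl⟩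
      obtain ⟨n, rfl⟩ := hσ r
      exact ⟨n, n.2, (hθσ n).symm⟩
    · rintro ⟨x, hx, rfl⟩
      exact ⟨σ ⟨x, hx⟩, hθσ ⟨x, hx⟩⟩
  -- the range has finite index `≤ [Δ : N_i]`
  haveI hNfi : (T.N i).FiniteIndex := T.N_finiteIndex i
  have hle : M.toSubgroup ≤ T.N i := by
    intro x hx
    obtain ⟨n, -, rfl⟩ := (hLmem x).1 hx
    exact n.2
  have hrange_fi : θ.range.FiniteIndex := by
    rw [hθrange]
    refine ⟨?_⟩
    rw [← Subgroup.index_comap_of_surjective _ (QuotientGroup.mk'_surjective M.toSubgroup),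
      Subgroup.comap_map_eq, QuotientGroup.ker_mk', sup_eq_left.mpr hle]
    exact hNfi.index_ne_zero
  -- transfer `G` along `θ`
  haveI := hG
  let K : Subgroup (Δ ⧸ M.toSubgroup) := G.map θ
  obtain ⟨hKfree, hKfin⟩ := IsFreeGroup.exists_isFreeGroup_finite_generators_of_mulEquiv
    (Subgroup.equivMapOfInjective G θ hθinj) ⟨hG, hGfin⟩
  have hKfi : K.FiniteIndex := by
    refine ⟨?_⟩
    change (G.map θ).index ≠ 0
    rw [G.index_map_of_injective hθinj]
    exact mul_ne_zero Subgroup.FiniteIndex.index_ne_zero hrange_fi.index_ne_zero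
  obtain ⟨a, ha, b, hb, hab⟩ := hab
  refine ⟨K, hKfree, hKfi, hKfin, θ a, ⟨a, ha, rfl⟩, θ b, ⟨b, hb, rfl⟩, fun h => hab (hθinj ?_)⟩
  rw [map_mul, map_mul]
  exact h

end SpecialFibreTower

/-! ### The bridge for `X : TemperedCurve p` -/

namespace TemperedCurve

variable {p : ℕ} [Fact p.Prime] (X : TemperedCurve p)

/-- **[SemiAnbd] Ex. 3.10 — the `Π`-normal André tower of `Δ^temp_X` from the special-fibre tower.**
Let `T` be a special-fibre tower over `Δ^temp_X` with (P0) admissible kernels normal in `Π^temp_{X_K}`,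
(h1) the inverse-limit topology "`Δ = lim Δ[i]`", and (B1′) a characteristic André tower at every level
chart `π₁^temp(𝒢_i)`.  Then inside every neighbourhood of `1` of `Π^temp_{X_K}` there is an open normal
subgroup `M` of `Δ^temp_X`, NORMAL IN `Π^temp_{X_K}`, with `Δ^temp_X/M` containing a free, finite-rank,
non-abelian subgroup of finite index (the input of `tower_of_piNormal_deltaTower`).
[cite: MochizukiSemiAnbd2006, Ex 3.10 pp.44-45] -/
theorem piNormal_deltaTower_of_specialFibreTower (T : SpecialFibreTower X.DeltaTemp)
    (hP0 : ∀ i, ((T.admKer i).map X.DeltaTemp.subtype).Normal)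
    (hlim : ∀ U ∈ 𝓝 (1 : X.DeltaTemp), ∃ i, ∃ V ∈ 𝓝 (1 : (T.chart i).G),
      ∀ n : T.N i, T.adm i n ∈ V → (n : X.DeltaTemp) ∈ U)
    (hch : ∀ i, ∀ V ∈ 𝓝 (1 : (T.chart i).G), ∃ MQ : OpenNormalSubgroup (T.chart i).G,
      (MQ : Set (T.chart i).G) ⊆ V ∧
      (∀ φ : (T.chart i).G ≃ₜ* (T.chart i).G,
        MQ.toSubgroup.map φ.toMulEquiv.toMonoidHom ≤ MQ.toSubgroup) ∧
      ∃ (G : Subgroup ((T.chart i).G ⧸ MQ.toSubgroup)) (_ : IsFreeGroup G), G.FiniteIndex ∧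
        Finite (IsFreeGroup.Generators G) ∧ ∃ a ∈ G, ∃ b ∈ G, a * b ≠ b * a) :
    ∀ U ∈ 𝓝 (1 : X.PiTemp), ∃ M : OpenNormalSubgroup X.DeltaTemp,
      (M.toSubgroup.map X.DeltaTemp.subtype).Normal ∧ (∀ x ∈ M, (x : X.PiTemp) ∈ U) ∧
      ∃ (G : Subgroup (X.DeltaTemp ⧸ M.toSubgroup)) (_ : IsFreeGroup G), G.FiniteIndex ∧
        Finite (IsFreeGroup.Generators G) ∧ ∃ a ∈ G, ∃ b ∈ G, a * b ≠ b * a := by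
  haveI : X.DeltaTemp.Normal := by unfold TemperedCurve.DeltaTemp; infer_instance
  intro U hU
  have hU' : ((↑) : X.DeltaTemp → X.PiTemp) ⁻¹' U ∈ 𝓝 (1 : X.DeltaTemp) :=
    continuous_subtype_val.continuousAt.preimage_mem_nhds (by simpa using hU)
  obtain ⟨i, V, hV, hVU⟩ := hlim _ hU'
  obtain ⟨MQ, hMQV, hchar, G, hG, hGfi, hGfin, hab⟩ := hch i V hV
  haveI := hGfi
  obtain ⟨M, hMpi, hMmem, K, hK, hKfi, hKfin, habK⟩ :=
    T.exists_openNormal_piNormal_of_charLevel hP0 i MQ hchar G hG hGfin hab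
  refine ⟨M, hMpi, fun x hx => ?_, K, hK, hKfi, hKfin, habK⟩
  obtain ⟨n, hn, rfl⟩ := (hMmem x).1 hx
  exact hVU n (hMQV hn)

/-- **[SemiAnbd] Ex. 3.10 — THE BRIDGE: `htower₀` for `Π^temp_{X_K}` from the special-fibre tower.**
For `X : TemperedCurve p` with `Π^temp_{X_K}` tempered and first countable, a special-fibre tower `T`
over `Δ^temp_X` with (P0) `Π`-normal admissible kernels, (h1) the inverse-limit topology
"`Δ = lim Δ[i]`" (p. 45), and (B1′) a characteristic André tower at every level `π₁^temp(𝒢_i)`, the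
group `Π^temp_{X_K}` has cofinally many open normal `N` with `Π^temp_{X_K}/N` containing a free,
normal, finite-index, finite-rank, non-abelian subgroup — VERBATIM the input `htower₀` of the cell's
[SemiAnbd] §6 / [EtTh] Lem. 2.17 (ii) discharges. [cite: MochizukiSemiAnbd2006, Ex 3.10 pp.44-45] -/
theorem tower_of_specialFibreTower (hT : IsTempered X.PiTemp) [FirstCountableTopology X.PiTemp]
    (T : SpecialFibreTower X.DeltaTemp)
    (hP0 : ∀ i, ((T.admKer i).map X.DeltaTemp.subtype).Normal)
    (hlim : ∀ U ∈ 𝓝 (1 : X.DeltaTemp), ∃ i, ∃ V ∈ 𝓝 (1 : (T.chart i).G),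
      ∀ n : T.N i, T.adm i n ∈ V → (n : X.DeltaTemp) ∈ U)
    (hch : ∀ i, ∀ V ∈ 𝓝 (1 : (T.chart i).G), ∃ MQ : OpenNormalSubgroup (T.chart i).G,
      (MQ : Set (T.chart i).G) ⊆ V ∧
      (∀ φ : (T.chart i).G ≃ₜ* (T.chart i).G,
        MQ.toSubgroup.map φ.toMulEquiv.toMonoidHom ≤ MQ.toSubgroup) ∧
      ∃ (G : Subgroup ((T.chart i).G ⧸ MQ.toSubgroup)) (_ : IsFreeGroup G), G.FiniteIndex ∧
        Finite (IsFreeGroup.Generators G) ∧ ∃ a ∈ G, ∃ b ∈ G, a * b ≠ b * a) :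
    ∀ U ∈ 𝓝 (1 : X.PiTemp), ∃ N : OpenNormalSubgroup X.PiTemp, (N : Set X.PiTemp) ⊆ U ∧
      ∃ (G : Subgroup (X.PiTemp ⧸ N.toSubgroup)) (_ : IsFreeGroup G), G.Normal ∧ G.FiniteIndex ∧
        Finite (IsFreeGroup.Generators G) ∧ ∃ a ∈ G, ∃ b ∈ G, a * b ≠ b * a :=
  X.tower_of_piNormal_deltaTower hT (X.piNormal_deltaTower_of_specialFibreTower T hP0 hlim hch)

/-- The bridge under the parameter bundle `d : X.GroupLevelData` of ruling η′ ("`Π^temp` tempered,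
Galois-countable"). [cite: MochizukiSemiAnbd2006, Ex 3.10 pp.44-45] -/
theorem tower_of_specialFibreTower' (d : X.GroupLevelData) (T : SpecialFibreTower X.DeltaTemp)
    (hP0 : ∀ i, ((T.admKer i).map X.DeltaTemp.subtype).Normal)
    (hlim : ∀ U ∈ 𝓝 (1 : X.DeltaTemp), ∃ i, ∃ V ∈ 𝓝 (1 : (T.chart i).G),
      ∀ n : T.N i, T.adm i n ∈ V → (n : X.DeltaTemp) ∈ U)
    (hch : ∀ i, ∀ V ∈ 𝓝 (1 : (T.chart i).G), ∃ MQ : OpenNormalSubgroup (T.chart i).G,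
      (MQ : Set (T.chart i).G) ⊆ V ∧
      (∀ φ : (T.chart i).G ≃ₜ* (T.chart i).G,
        MQ.toSubgroup.map φ.toMulEquiv.toMonoidHom ≤ MQ.toSubgroup) ∧
      ∃ (G : Subgroup ((T.chart i).G ⧸ MQ.toSubgroup)) (_ : IsFreeGroup G), G.FiniteIndex ∧
        Finite (IsFreeGroup.Generators G) ∧ ∃ a ∈ G, ∃ b ∈ G, a * b ≠ b * a) :
    ∀ U ∈ 𝓝 (1 : X.PiTemp), ∃ N : OpenNormalSubgroup X.PiTemp, (N : Set X.PiTemp) ⊆ U ∧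
      ∃ (G : Subgroup (X.PiTemp ⧸ N.toSubgroup)) (_ : IsFreeGroup G), G.Normal ∧ G.FiniteIndex ∧
        Finite (IsFreeGroup.Generators G) ∧ ∃ a ∈ G, ∃ b ∈ G, a * b ≠ b * a := by
  haveI := d.secondCountableTopology
  exact X.tower_of_specialFibreTower d.isTempered T hP0 hlim hch

/-- The `Δ^temp_X`-form of the bridge (composition with abc-iut-w5-d139's
`deltaTemp_tower_of_tower_of_isTempered`). [cite: MochizukiSemiAnbd2006, Ex 3.10 pp.44-45] -/
theorem deltaTemp_tower_of_specialFibreTower (hT : IsTempered X.PiTemp)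
    [FirstCountableTopology X.PiTemp] (T : SpecialFibreTower X.DeltaTemp)
    (hP0 : ∀ i, ((T.admKer i).map X.DeltaTemp.subtype).Normal)
    (hlim : ∀ U ∈ 𝓝 (1 : X.DeltaTemp), ∃ i, ∃ V ∈ 𝓝 (1 : (T.chart i).G),
      ∀ n : T.N i, T.adm i n ∈ V → (n : X.DeltaTemp) ∈ U)
    (hch : ∀ i, ∀ V ∈ 𝓝 (1 : (T.chart i).G), ∃ MQ : OpenNormalSubgroup (T.chart i).G,
      (MQ : Set (T.chart i).G) ⊆ V ∧
      (∀ φ : (T.chart i).G ≃ₜ* (T.chart i).G,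
        MQ.toSubgroup.map φ.toMulEquiv.toMonoidHom ≤ MQ.toSubgroup) ∧
      ∃ (G : Subgroup ((T.chart i).G ⧸ MQ.toSubgroup)) (_ : IsFreeGroup G), G.FiniteIndex ∧
        Finite (IsFreeGroup.Generators G) ∧ ∃ a ∈ G, ∃ b ∈ G, a * b ≠ b * a) :
    ∀ U ∈ 𝓝 (1 : X.DeltaTemp), ∃ N : OpenNormalSubgroup X.DeltaTemp, (N : Set X.DeltaTemp) ⊆ U ∧
      ∃ (G : Subgroup (X.DeltaTemp ⧸ N.toSubgroup)) (_ : IsFreeGroup G), G.Normal ∧ G.FiniteIndex ∧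
        Finite (IsFreeGroup.Generators G) ∧ ∃ a ∈ G, ∃ b ∈ G, a * b ≠ b * a :=
  X.deltaTemp_tower_of_tower_of_isTempered hT (X.tower_of_specialFibreTower hT T hP0 hlim hch)

end TemperedCurve

end Literature.AnabelianGeometry.SemiGraphs

end
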